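import Literature.NumberTheory.LFunctions.WeilFirstPrimeCertificate
import HarnessLib

/-!
# Row-wise kernel checks for the parity blocks of a Weil certificate

Topic: `Literature/NumberTheory/LFunctions`. The block check `WeilCert.checkBlockK` (`D C = I` and
`R = S' − UᵀU` diagonally dominant, `S' = Dᵀ P_r D + κ (2 diag b − (b bᵀ) ∘ (C H Cᵀ))`,
`WeilFirstPrimeCertificate.lean`) materialises whole `nb × nb` products; for `nb = 50` with
hundred-digit entries one kernel declaration runs out of memory. Here the same facts are checked ROW BY
ROW — `checkDCRow p i` and `checkDomRow ν κ p i` compute only row `i` (`(Dᵀ P_r)_i`, then `· D`, the row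
of `C H` then `· Cᵀ`, the row of `UᵀU`; about `5 nb²` products) — and **`checkBlockK_of_rows`** recovers
`checkBlockK ν κ p = true` from the `2 nb` row checks, using the symmetry of `R` (`getM_rBlkK_symm`)
for the one-sided dominance test. Pure bookkeeping; everything here is proved.
-/

noncomputable section

open Finset
open scoped BigOperators

namespace Literature.NumberTheory.LFunctions

namespace WeilCert

variable (c : WeilCert)

/-! ## Row-wise computations -/

/-- Row `i` of `Dᵀ P_r`: `w_l = Σ_k D_{ki} P_r(2k+p, 2l+p)`. [folklore] -/
def dtpRow (nu : List ℚ) (p i : ℕ) : List ℚ :=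
  tabV c.nb fun l ↦ sumR c.nb fun k ↦ getM (c.Db p) k i * c.prQ nu (2 * k + p) (2 * l + p)

/-- Row `i` of `C H`: `Σ_k C_{ik} H_{kl}`. [folklore] -/
def chRow (p i : ℕ) : List ℚ :=
  tabV c.nb fun l ↦ sumR c.nb fun k ↦ getM (c.Cb p) i k * c.hBlkQ p k l

/-- Row `i` of `R = S' − UᵀU` from the two row vectors. [folklore] -/
def rRow (nu : List ℚ) (κ : ℚ) (p i : ℕ) : List ℚ :=
  let w := c.dtpRow nu p i
  let ch := c.chRow p i
  tabV c.nb fun j ↦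
    ((sumR c.nb fun l ↦ getV w l * getM (c.Db p) l j) +
        κ * ((if i = j then 2 * c.bQ p i else 0) -
          c.bQ p i * c.bQ p j * (sumR c.nb fun l ↦ getV ch l * getM (c.Cb p) j l))) -
      sumR c.nb fun k ↦ getM (c.Ub p) k i * getM (c.Ub p) k j

/-- One-sided dominance of row `i` of `R` (the matrix is symmetric): `Σ_{j ≠ i} |R_{ij}| ≤ R_{ii}`. [folklore] -/
def checkDomRow (nu : List ℚ) (κ : ℚ) (p i : ℕ) : Bool :=
  let r := c.rRow nu κ p i
  decide ((sumR c.nb fun j ↦ if j = i then 0 else |getV r j|) ≤ getV r i)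

/-- Row `i` of the check `D C = I`. [folklore] -/
def checkDCRow (p i : ℕ) : Bool :=
  allBelow c.nb fun j ↦
    decide ((sumR c.nb fun k ↦ getM (c.Db p) i k * getM (c.Cb p) k j) = if i = j then 1 else 0)

variable {c}

/-! ## The row computation agrees with the materialized `R` -/

/-- Entries of the row computation are the entries of `R = S' − UᵀU`. [folklore] -/
theorem getV_rRow (nu : List ℚ) (κ : ℚ) (p : ℕ) {i j : ℕ} (hi : i < c.nb) (hj : j < c.nb) :
    getV (c.rRow nu κ p i) j = getM (c.rBlkK nu κ p) i j := by
  rw [c.getM_rBlkK nu p κ hi hj, c.getM_spBlkK nu p κ hi hj, c.getM_hpBlk p hi hj]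
  unfold rRow
  dsimp only
  rw [getV_tabV _ hj, sumR_eq_sum, sumR_eq_sum, sumR_eq_sum]
  congr 1
  congr 1
  · -- `Σ_l (Σ_k D_{ki} P_{kl}) D_{lj} = Σ_k D_{ki} Σ_l P_{kl} D_{lj}`
    have hw : ∀ l ∈ range c.nb, getV (c.dtpRow nu p i) l =
        ∑ k ∈ range c.nb, getM (c.Db p) k i * c.prQ nu (2 * k + p) (2 * l + p) := by
      intro l hl
      unfold dtpRow
      rw [getV_tabV _ (Finset.mem_range.1 hl), sumR_eq_sum]
    rw [Finset.sum_congr rfl fun l hl ↦ by rw [hw l hl]]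
    simp_rw [Finset.sum_mul, Finset.mul_sum]
    rw [Finset.sum_comm]
    refine Finset.sum_congr rfl fun k _ ↦ Finset.sum_congr rfl fun l _ ↦ ?_
    ring
  · have hch : ∀ l ∈ range c.nb, getV (c.chRow p i) l =
        ∑ k ∈ range c.nb, getM (c.Cb p) i k * c.hBlkQ p k l := by
      intro l hl
      unfold chRow
      rw [getV_tabV _ (Finset.mem_range.1 hl), sumR_eq_sum]
    rw [Finset.sum_congr rfl fun l hl ↦ by rw [hch l hl]]

/-! ## Symmetry of `R` -/

/-- `P` is symmetric. [folklore] -/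
theorem pmQ_symm (nu : List ℚ) (k l : ℕ) : c.pmQ nu k l = c.pmQ nu l k := by
  unfold pmQ
  by_cases hkl : k % 2 = l % 2
  · rw [if_pos hkl, if_pos hkl.symm]
    have hs : (-1 : ℚ) ^ k = (-1) ^ l := by
      rw [neg_one_pow_eq_pow_mod_two (R := ℚ) (n := k), neg_one_pow_eq_pow_mod_two (R := ℚ) (n := l), hkl]
    rw [hs, Nat.add_comm l k]
    ring
  · rw [if_neg hkl, if_neg (fun h ↦ hkl h.symm)]

/-- `P_r` is symmetric. [folklore] -/
theorem prQ_symm (nu : List ℚ) (k l : ℕ) : c.prQ nu k l = c.prQ nu l k := by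
  unfold prQ; rw [c.pmQ_symm nu k l]

/-- `H` is symmetric. [folklore] -/
theorem hBlkQ_symm (p k l : ℕ) : c.hBlkQ p k l = c.hBlkQ p l k := by
  unfold hBlkQ; rw [add_comm ((2 * k + p : ℕ) : ℚ) ((2 * l + p : ℕ) : ℚ)]

/-- `R = S' − UᵀU` is symmetric. [folklore] -/
theorem getM_rBlkK_symm (nu : List ℚ) (κ : ℚ) (p : ℕ) {i j : ℕ} (hi : i < c.nb) (hj : j < c.nb) :
    getM (c.rBlkK nu κ p) i j = getM (c.rBlkK nu κ p) j i := by
  rw [c.getM_rBlkK nu p κ hi hj, c.getM_rBlkK nu p κ hj hi, c.getM_spBlkK nu p κ hi hj,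
    c.getM_spBlkK nu p κ hj hi, c.getM_hpBlk p hi hj, c.getM_hpBlk p hj hi]
  have hP : ∑ k ∈ range c.nb, getM (c.Db p) k i *
      ∑ l ∈ range c.nb, c.prQ nu (2 * k + p) (2 * l + p) * getM (c.Db p) l j =
      ∑ k ∈ range c.nb, getM (c.Db p) k j *
        ∑ l ∈ range c.nb, c.prQ nu (2 * k + p) (2 * l + p) * getM (c.Db p) l i := by
    simp_rw [Finset.mul_sum]
    rw [Finset.sum_comm]
    refine Finset.sum_congr rfl fun k _ ↦ Finset.sum_congr rfl fun l _ ↦ ?_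
    rw [c.prQ_symm nu (2 * l + p) (2 * k + p)]
    ring
  have hH : ∑ l ∈ range c.nb, (∑ k ∈ range c.nb, getM (c.Cb p) i k * c.hBlkQ p k l) * getM (c.Cb p) j l =
      ∑ l ∈ range c.nb, (∑ k ∈ range c.nb, getM (c.Cb p) j k * c.hBlkQ p k l) * getM (c.Cb p) i l := by
    simp_rw [Finset.sum_mul]
    rw [Finset.sum_comm]
    refine Finset.sum_congr rfl fun k _ ↦ Finset.sum_congr rfl fun l _ ↦ ?_
    rw [c.hBlkQ_symm p l k]
    ring
  have hU : ∑ k ∈ range c.nb, getM (c.Ub p) k i * getM (c.Ub p) k j =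
      ∑ k ∈ range c.nb, getM (c.Ub p) k j * getM (c.Ub p) k i :=
    Finset.sum_congr rfl fun k _ ↦ mul_comm _ _
  rw [hP, hH, hU]
  by_cases hij : i = j
  · subst hij; rfl
  · rw [if_neg hij, if_neg (fun h ↦ hij h.symm)]
    ring

/-! ## Assembling the block check from its rows -/

/-- **`checkBlockK` from the row checks.** [folklore] -/
theorem checkBlockK_of_rows {nu : List ℚ} {κ : ℚ} {p : ℕ}
    (hdc : ∀ i < c.nb, c.checkDCRow p i = true) (hdom : ∀ i < c.nb, c.checkDomRow nu κ p i = true) :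
    c.checkBlockK nu κ p = true := by
  unfold checkBlockK
  rw [Bool.and_eq_true]
  constructor
  · -- `checkDC` is literally the conjunction of the rows
    unfold checkDC
    exact WeilCert2.allBelow_of_forall fun i hi ↦ hdc i hi
  · unfold checkDom
    refine WeilCert2.allBelow_of_forall fun i hi ↦ ?_
    rw [decide_eq_true_eq, sumR_eq_sum]
    have h := hdom i hi
    unfold checkDomRow at h
    rw [decide_eq_true_eq, sumR_eq_sum, getV_rRow nu κ p hi hi] at h
    refine le_trans (le_of_eq ?_) h
    refine Finset.sum_congr rfl fun j hj ↦ ?_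
    have hj' := Finset.mem_range.1 hj
    by_cases hji : j = i
    · rw [if_pos hji, if_pos hji]
    · rw [if_neg hji, if_neg hji, getV_rRow nu κ p hi hj', ← c.getM_rBlkK_symm nu κ p hi hj']
      ring

end WeilCert

end Literature.NumberTheory.LFunctions
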